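import Literature.NumberTheory.Sieve.MaynardSieveLemma62
import Literature.NumberTheory.Sieve.MaynardSieveS2
import Literature.NumberTheory.Sieve.MaynardTaoLargeKProofs
import HarnessLib

/-!
# Maynard 2015, proof of Lemma 6.3, (6.12)–(6.14) proved: the named fact `Literature.NumberTheory.Sieve.maynard_lemma63_sum`

Topic `Literature/NumberTheory/Sieve`; sequel of `MaynardSieveLemma62.lean` (the analogous evaluation
(6.4)–(6.7) for `S₁`) and companion of `MaynardSieveS2.lean`, which reduces the `S₂` half of
Proposition 4.1 (`Literature.NumberTheory.Sieve.maynard_S2_asymptotic` = Lemma 6.3) to three named facts: Lemma 5.2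
(`maynard_lemma52`), the evaluation of `y^{(m)}` (`maynard_lemma63_ym`) and the evaluation of the
resulting smooth sum (`maynard_lemma63_sum`). J. Maynard, *Small gaps between primes*, Ann. of Math.
(2) 181 (2015), 383–413 = arXiv:1311.4600v3, proof of Lemma 6.3, p. 14, displays (6.12)–(6.14):
`∑_{r : r_m = 1, r good} (∏ᵢ weight(rᵢ)) (F^{(m)}_r)² = (φ(W)/W)^{k−1} (log R)^{k−1} (J_k^{(m)}(F) + o(1))`.

Everything in this file is PROVED (theorems only); the main result is
`maynard_lemma63_sum_holds : maynard_lemma63_sum`. Writing `k = n + 1`: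

* `sum_filter_slot_eq`, `prod_weight_insertNth`, `maynardFm_insertNth`, `sum_lemma63_eq_sum_good` —
  (6.12): the tuples with `r_m = 1` are the `n`-tuples `s` of the other coordinates
  (`r = insertNth m 1 s`), the weight `∏ᵢ φ(rᵢ)²/(g(rᵢ) rᵢ²)` is `∏ⱼ w_{cJ}(sⱼ)/sⱼ` with the squarefree
  weights `wfun` of `CoprimeSquarefreeSums` (`c_p = 1/((p−2)p)`, `wfun_cJ_div`, `W` even), and
  `F^{(m)}_r = g_m(x_s)`, `g_m(x) = ∫₀¹ F(insertNth m u x) du` the fibre integral of `F = 1_{R_k} G`;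
* `sum_prod_wfun_not_isGood_le`, `abs_sum_bad_wfun_le` — (6.13): relaxing "`∏ sⱼ` squarefree" to
  "each `sⱼ` squarefree" costs at most `G_max² n² L^n (1 + C₀)²/D₀` for any weight `w_c/id` with
  `|c_p| ≤ C₀/p` (union bound over the pairs of coordinates sharing a prime `p > D₀`,
  multiplicativity `w(pm)/(pm) = (w(p)/p)(w(m)/m)`, `∑_{p > D₀} 1/p² ≤ 1/D₀`) — the general-weight
  version of the bound of `MaynardSieveLemma62.lean`;
* `continuousOn_fibreIntegral` — `g_m` is continuous on `[0,1]^n` (dominated convergence: for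
  `u ≠ 1 − ∑ x₀ⱼ` the integrand is continuous in `x` within the cube at `x₀`), so that the `n`
  applications of Lemma 6.1 in (6.14) can be replaced by the tree's Riemann-sum estimate
  `MaynardTao.abs_weightedSum_sub_integral_le` (with no linear constraint, `polytope_empty_eq`), fed
  with the counting function of `w_{cJ}/id` (`SquarefreeSums.abs_sum_wfun_div_sub_log_le`);
  `∫_{[0,1]^n} g_m² = J_k^{(m)}(F)` is `MaynardLargeK.maynardJ_eq_integral_insertNth`
  (`integral_cube_fibre_sq_eq`); the degenerate case `n = 0` is `weightedSum_zero`,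
  `integral_maynardCube_zero`;
* `maynard_lemma63_sum_holds` — the assembly in `o`-form, with the bookkeeping of
  `MaynardSieveLemma51.lean`/`MaynardSieveLemma62.lean` (`D₀ = ⌊log log log N⌋ → ∞`,
  `8^{D₀} ≤ (log log N)³`, `φ(W)/W ≥ 1/D₀`, `L ≤ (2 + B(1)) (φ(W)/W) log R`).

After this file and `MaynardSieveLemma62.lean`, Proposition 4.1 along `MaynardSieve.lean` rests on
Lemma 5.2 (`maynard_lemma52`) and the evaluation of `y^{(m)}` (`maynard_lemma63_ym`) alone.

## References

* J. Maynard, *Small gaps between primes*, Ann. of Math. (2) 181 (2015), 383–413,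
  doi:10.4007/annals.2015.181.1.7 = arXiv:1311.4600v3: Lemma 6.3 and its proof, (6.10)–(6.14),
  p. 14; Lemma 6.1 (quoted from Goldston–Graham–Pintz–Yıldırım, Proc. LMS 98 (2009), Lemma 4).
  [cite: MaynardAnnals2015]
-/

open Finset Filter Asymptotics MeasureTheory

open scoped ArithmeticFunction.Moebius

namespace Literature.NumberTheory.Sieve

/-- The prime weight of `μ²(n) φ(n)²/(g(n) n)`, `g(p) = p − 2`: `c_p = 1/((p − 2) p)` (so that
`(1 + c_p)/p = (p−1)²/((p−2)p²)`; at `p = 2` the value is `1/0 = 0`, irrelevant since `2 ∣ W`); a local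
notation, not a declaration. [cite: MaynardAnnals2015, proof of Lemma 6.3, (6.13)] -/
local notation "cJ" => (fun p : ℕ => (1 : ℝ) / (((p : ℝ) - 2) * p))

namespace MaynardSieve

variable {k : ℕ}


/-! ### Product weights `w_c(n)/n`: nonnegativity, multiplicativity, bad tuples -/

/-- `w_c(n)/n ≥ 0` when `1 + c_p ≥ 0` at every prime. [folklore] -/
theorem wfun_div_nonneg {W : ℕ} {c : ℕ → ℝ} (hc : ∀ p, p.Prime → 0 ≤ 1 + c p) (n : ℕ) :
    0 ≤ SquarefreeSums.wfun W c n / n := by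
  refine div_nonneg ?_ (Nat.cast_nonneg n)
  rw [SquarefreeSums.wfun_apply]
  split_ifs with h
  · exact Finset.prod_nonneg fun p hp => hc p (Nat.prime_of_mem_primeFactors hp)
  · exact le_rfl

/-- `w_c(pm)/(pm) = (w_c(p)/p)(w_c(m)/m)` for a prime `p ∤ m` (multiplicativity). [folklore] -/
theorem wfun_div_prime_mul {W : ℕ} {c : ℕ → ℝ} {p m : ℕ} (hp : p.Prime) (hpm : ¬p ∣ m) :
    SquarefreeSums.wfun W c (p * m) / ((p * m : ℕ) : ℝ) =
      SquarefreeSums.wfun W c p / p * (SquarefreeSums.wfun W c m / m) := by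
  have hcop : Nat.Coprime p m := (Nat.Prime.coprime_iff_not_dvd hp).2 hpm
  rw [SquarefreeSums.isMultiplicative_wfun.map_mul_of_coprime hcop]
  push_cast
  rw [div_mul_div_comm]

/-- `w_c(p)/p ≤ (1 + C₀)/p` at a prime `p ∤ W`... in general `w_c(p)/p ≤ (1 + C₀)/p` when
`|c_p| ≤ C₀/p`. [folklore] -/
theorem wfun_div_prime_le {W : ℕ} {c : ℕ → ℝ} {C₀ : ℝ} (hc : ∀ p, p.Prime → |c p| ≤ C₀ / p)
    {p : ℕ} (hp : p.Prime) : SquarefreeSums.wfun W c p / p ≤ (1 + C₀) / p := by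
  have hp1 : (1 : ℝ) ≤ p := by exact_mod_cast hp.one_le
  have hp0 : (0 : ℝ) < p := by linarith
  refine div_le_div_of_nonneg_right ?_ hp0.le
  have h := SquarefreeSums.wfun_apply_prime_pow (W := W) (c := c) hp one_ne_zero
  rw [pow_one] at h
  rw [h]
  have hC0 : 0 ≤ C₀ := by
    have := (abs_nonneg _).trans (hc p hp)
    exact (div_nonneg_iff.1 this).elim (fun h => h.1) fun h => by linarith [h.2]
  split_ifs
  · linarith
  · have h1 := (abs_le.1 (hc p hp)).2
    have h2 : C₀ / p ≤ C₀ := div_le_self hC0 hp1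
    linarith
  · linarith

/-- `∑_{n ∈ G1, p ∣ n} w(n)/n ≤ (w(p)/p) · ∑_{n ∈ G1} w(n)/n` for a prime `p`: `n ↦ n/p` is injective into
`G1` and `w(n)/n = (w(p)/p)(w(n/p)/(n/p))` (`n` squarefree). [cite: MaynardAnnals2015, proof of Lemma 6.2, (6.5)] -/
theorem sum_G1_filter_dvd_wfun_le {W B p : ℕ} (hp : p.Prime) {c : ℕ → ℝ}
    (hc : ∀ p, p.Prime → 0 ≤ 1 + c p) :
    ∑ n ∈ (G1 W B).filter (fun n => p ∣ n), SquarefreeSums.wfun W c n / n ≤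
      SquarefreeSums.wfun W c p / p * ∑ n ∈ G1 W B, SquarefreeSums.wfun W c n / n := by
  have hphi : ∀ n ∈ (G1 W B).filter (fun n => p ∣ n),
      SquarefreeSums.wfun W c n / n =
        SquarefreeSums.wfun W c p / p * (SquarefreeSums.wfun W c (n / p) / ((n / p : ℕ) : ℝ)) := by
    intro n hn
    rw [Finset.mem_filter, mem_G1] at hn
    obtain ⟨⟨-, hsq, -⟩, hpn⟩ := hn
    obtain ⟨t, rfl⟩ := hpn
    have hpt : ¬p ∣ t := by
      intro hpt
      obtain ⟨u, rfl⟩ := hpt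
      have : p * p ∣ p * (p * u) := ⟨u, by ring⟩
      exact hp.ne_one (Nat.isUnit_iff.1 (hsq p this))
    rw [Nat.mul_div_cancel_left t hp.pos]
    exact wfun_div_prime_mul hp hpt
  rw [Finset.sum_congr rfl hphi, ← Finset.mul_sum]
  refine mul_le_mul_of_nonneg_left ?_ (wfun_div_nonneg hc p)
  have hinj : Set.InjOn (fun n => n / p) ((G1 W B).filter (fun n => p ∣ n) : Set ℕ) := by
    intro n hn n' hn' h
    rw [Finset.coe_filter] at hn hn'
    have h1 := Nat.div_mul_cancel hn.2
    have h2 := Nat.div_mul_cancel hn'.2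
    have h3 : n / p * p = n' / p * p := by rw [show n / p = n' / p from h]
    rw [h1, h2] at h3
    exact h3
  rw [← Finset.sum_image (f := fun m => SquarefreeSums.wfun W c m / m) hinj]
  refine Finset.sum_le_sum_of_subset_of_nonneg (fun m hm => ?_) fun _ _ _ => wfun_div_nonneg hc _
  rw [Finset.mem_image] at hm
  obtain ⟨n, hn, rfl⟩ := hm
  rw [Finset.mem_filter] at hn
  exact mem_G1_of_dvd hn.1 (Nat.div_dvd_of_dvd hn.2)

/-- The product weight `∏ᵢ w(tᵢ)/tᵢ` summed over the coordinatewise good tuples with `p ∣ tᵢ`, `p ∣ tⱼ`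
(`i ≠ j`) is at most `(w(p)/p)² L^k`, `L = ∑_{n ∈ G1} w(n)/n`. [cite: MaynardAnnals2015, (6.5)] -/
theorem sum_prod_wfun_filter_dvd_le {W B p : ℕ} (hp : p.Prime) {c : ℕ → ℝ}
    (hc : ∀ p, p.Prime → 0 ≤ 1 + c p) {i j : Fin k} (hij : i ≠ j) :
    ∑ t ∈ (Fintype.piFinset fun _ : Fin k => G1 W B).filter (fun t => p ∣ t i ∧ p ∣ t j),
        ∏ l, SquarefreeSums.wfun W c (t l) / (t l) ≤
      (SquarefreeSums.wfun W c p / p) ^ 2 * (∑ n ∈ G1 W B, SquarefreeSums.wfun W c n / n) ^ k := by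
  classical
  set f : ℕ → ℝ := fun n => SquarefreeSums.wfun W c n / n with hf
  set L := ∑ n ∈ G1 W B, f n with hL
  set Lp := ∑ n ∈ (G1 W B).filter (fun n => p ∣ n), f n with hLp
  have hf0 : ∀ n, 0 ≤ f n := fun n => wfun_div_nonneg hc n
  have hL0 : 0 ≤ L := Finset.sum_nonneg fun _ _ => hf0 _
  have hLp0 : 0 ≤ Lp := Finset.sum_nonneg fun _ _ => hf0 _
  have hLpL : Lp ≤ f p * L := sum_G1_filter_dvd_wfun_le hp hc
  -- the filtered box is a product box
  set T : Fin k → Finset ℕ := fun l => if l = i ∨ l = j then (G1 W B).filter (fun n => p ∣ n) else G1 W B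
    with hT
  have hset : (Fintype.piFinset fun _ : Fin k => G1 W B).filter (fun t => p ∣ t i ∧ p ∣ t j) =
      Fintype.piFinset T := by
    ext t
    simp only [Finset.mem_filter, Fintype.mem_piFinset, hT]
    constructor
    · rintro ⟨h, hi, hj⟩ l
      by_cases hl : l = i ∨ l = j
      · rw [if_pos hl, Finset.mem_filter]
        rcases hl with rfl | rfl
        · exact ⟨h l, hi⟩
        · exact ⟨h l, hj⟩
      · rw [if_neg hl]; exact h l
    · intro h
      have hmem : ∀ l, t l ∈ G1 W B := fun l => by
        have := h l
        by_cases hl : l = i ∨ l = j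
        · rw [if_pos hl, Finset.mem_filter] at this; exact this.1
        · rwa [if_neg hl] at this
      have hi := h i
      have hj := h j
      rw [if_pos (Or.inl rfl), Finset.mem_filter] at hi
      rw [if_pos (Or.inr rfl), Finset.mem_filter] at hj
      exact ⟨hmem, hi.2, hj.2⟩
  rw [hset]
  have hprod : ∑ t ∈ Fintype.piFinset T, ∏ l, SquarefreeSums.wfun W c (t l) / (t l) =
      ∏ l, ∑ n ∈ T l, f n := by
    rw [Finset.prod_univ_sum T (fun _ n => f n)]
  rw [hprod]
  have hfac : ∀ l, ∑ n ∈ T l, f n = if l = i ∨ l = j then Lp else L := by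
    intro l
    by_cases hl : l = i ∨ l = j
    · simp only [hT, if_pos hl, hLp]
    · simp only [hT, if_neg hl, hL]
  simp_rw [hfac]
  rw [← Finset.mul_prod_erase _ _ (Finset.mem_univ i), if_pos (Or.inl rfl),
    ← Finset.mul_prod_erase _ _ (Finset.mem_erase.2 ⟨hij.symm, Finset.mem_univ j⟩),
    if_pos (Or.inr rfl)]
  have hrest : ∏ x ∈ (Finset.univ.erase i).erase j, (if x = i ∨ x = j then Lp else L) = L ^ (k - 2) := by
    calc _ = ∏ x ∈ (Finset.univ.erase i).erase j, L := by
          refine Finset.prod_congr rfl fun x hx => ?_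
          rw [Finset.mem_erase, Finset.mem_erase] at hx
          rw [if_neg (not_or.2 ⟨hx.2.1, hx.1⟩)]
      _ = L ^ (k - 2) := by
          rw [Finset.prod_const]
          congr 1
          rw [Finset.card_erase_of_mem (Finset.mem_erase.2 ⟨hij.symm, Finset.mem_univ j⟩),
            Finset.card_erase_of_mem (Finset.mem_univ i), Finset.card_univ, Fintype.card_fin]
          omega
  rw [hrest]
  have hk2 : 2 ≤ k := by
    have h2 : ({i, j} : Finset (Fin k)).card ≤ Fintype.card (Fin k) := Finset.card_le_univ _
    rw [Finset.card_pair hij, Fintype.card_fin] at h2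
    exact h2
  have hfpL : 0 ≤ f p * L := mul_nonneg (hf0 p) hL0
  calc Lp * (Lp * L ^ (k - 2)) ≤ (f p * L) * ((f p * L) * L ^ (k - 2)) := by gcongr
    _ = f p ^ 2 * L ^ (k - 2 + 2) := by rw [pow_add]; ring
    _ = f p ^ 2 * L ^ k := by rw [Nat.sub_add_cancel hk2]

/-- **The bad tuples for a general product weight** (Maynard 2015, (6.5) and (6.12)→(6.13)): the total
weight `∏ w(tᵢ)/tᵢ` of the coordinatewise good tuples of `[1, B]^k` that are not good is at most
`k² L^k (1 + C₀)²/D₀` (`|c_p| ≤ C₀/p`, `1 + c_p ≥ 0`, every prime `≤ D₀` divides `W`).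
[cite: MaynardAnnals2015, proof of Lemma 6.2, (6.5)] -/
theorem sum_prod_wfun_not_isGood_le {W B D₀ : ℕ} (hD1 : 1 ≤ D₀)
    (hD : ∀ p, p.Prime → p ≤ D₀ → p ∣ W) {c : ℕ → ℝ} {C₀ : ℝ}
    (hc : ∀ p, p.Prime → |c p| ≤ C₀ / p) (hc1 : ∀ p, p.Prime → 0 ≤ 1 + c p) :
    ∑ t ∈ (Fintype.piFinset fun _ : Fin k => G1 W B).filter (fun t => ¬IsGood W t),
        ∏ l, SquarefreeSums.wfun W c (t l) / (t l) ≤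
      (k : ℝ) ^ 2 * (∑ n ∈ G1 W B, SquarefreeSums.wfun W c n / n) ^ k * ((1 + C₀) ^ 2 / (D₀ : ℝ)) := by
  classical
  have hf0 : ∀ n, 0 ≤ SquarefreeSums.wfun W c n / n := fun n => wfun_div_nonneg hc1 n
  have hL0 : 0 ≤ ∑ n ∈ G1 W B, SquarefreeSums.wfun W c n / n := Finset.sum_nonneg fun _ _ => hf0 _
  have hw0 : ∀ t ∈ (Fintype.piFinset fun _ : Fin k => G1 W B),
      0 ≤ ∏ l, SquarefreeSums.wfun W c (t l) / (t l) :=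
    fun t _ => Finset.prod_nonneg fun _ _ => hf0 _
  have hC0 : 0 ≤ 1 + C₀ := by
    have := (abs_nonneg _).trans (hc 2 Nat.prime_two)
    have h2 : 0 ≤ C₀ := by
      rcases div_nonneg_iff.1 this with h | h
      · exact h.1
      · linarith [h.2]
    linarith
  -- the "reasons" `q = ((i, j), p)`
  obtain ⟨Q, hQ⟩ : ∃ Q : Finset ((Fin k × Fin k) × ℕ),
      Q = (Finset.univ : Finset (Fin k)).offDiag ×ˢ (Finset.Ioc D₀ B).filter Nat.Prime := ⟨_, rfl⟩
  obtain ⟨C, hC⟩ : ∃ C : ((Fin k × Fin k) × ℕ) → (Fin k → ℕ) → Prop,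
      C = fun q t => q.2 ∣ t q.1.1 ∧ q.2 ∣ t q.1.2 := ⟨_, rfl⟩
  have step1 : ∑ t ∈ (Fintype.piFinset fun _ : Fin k => G1 W B).filter (fun t => ¬IsGood W t),
        ∏ l, SquarefreeSums.wfun W c (t l) / (t l) ≤
      ∑ t ∈ (Fintype.piFinset fun _ : Fin k => G1 W B).filter (fun t => ∃ q ∈ Q, C q t),
        ∏ l, SquarefreeSums.wfun W c (t l) / (t l) := by
    refine Finset.sum_le_sum_of_subset_of_nonneg (fun t ht => ?_)
      fun t ht _ => hw0 t (Finset.mem_filter.1 ht).1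
    rw [Finset.mem_filter] at ht ⊢
    refine ⟨ht.1, ?_⟩
    have hmem : ∀ i, t i ∈ G1 W B := fun i => Fintype.mem_piFinset.1 ht.1 i
    obtain ⟨ij, hij, p, hp, h1, h2⟩ := exists_prime_dvd_two_of_not_isGood hD hmem ht.2
    refine ⟨(ij, p), ?_, ?_⟩
    · rw [hQ, Finset.mem_product]; exact ⟨hij, hp⟩
    · rw [hC]; exact ⟨h1, h2⟩
  have step2 : ∑ t ∈ (Fintype.piFinset fun _ : Fin k => G1 W B).filter (fun t => ∃ q ∈ Q, C q t),
        ∏ l, SquarefreeSums.wfun W c (t l) / (t l) ≤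
      ∑ q ∈ Q, ∑ t ∈ (Fintype.piFinset fun _ : Fin k => G1 W B).filter (C q),
        ∏ l, SquarefreeSums.wfun W c (t l) / (t l) :=
    sum_filter_exists_le Q _ C _ hw0
  have step3 : ∀ q ∈ Q, ∑ t ∈ (Fintype.piFinset fun _ : Fin k => G1 W B).filter (C q),
        ∏ l, SquarefreeSums.wfun W c (t l) / (t l) ≤
      (∑ n ∈ G1 W B, SquarefreeSums.wfun W c n / n) ^ k * ((1 + C₀) ^ 2 / (q.2 : ℝ) ^ 2) := by
    intro q hq
    rw [hQ, Finset.mem_product, Finset.mem_offDiag, Finset.mem_filter] at hq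
    have hp := hq.2.2
    have h := sum_prod_wfun_filter_dvd_le (W := W) (B := B) hp hc1 hq.1.2.2
    have hfilt : (Fintype.piFinset fun _ : Fin k => G1 W B).filter (C q) =
        (Fintype.piFinset fun _ : Fin k => G1 W B).filter (fun t => q.2 ∣ t q.1.1 ∧ q.2 ∣ t q.1.2) :=
      Finset.filter_congr fun t _ => by rw [hC]
    rw [hfilt]
    refine h.trans ?_
    have hfp := wfun_div_prime_le (W := W) hc hp
    have hp0 : (0 : ℝ) < q.2 := by exact_mod_cast hp.pos
    calc (SquarefreeSums.wfun W c q.2 / q.2) ^ 2 * (∑ n ∈ G1 W B, SquarefreeSums.wfun W c n / n) ^ k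
        ≤ ((1 + C₀) / q.2) ^ 2 * (∑ n ∈ G1 W B, SquarefreeSums.wfun W c n / n) ^ k := by
          gcongr
          exact hf0 _
      _ = _ := by rw [div_pow]; ring
  have step4 : ∑ q ∈ Q, (∑ n ∈ G1 W B, SquarefreeSums.wfun W c n / n) ^ k * ((1 + C₀) ^ 2 / (q.2 : ℝ) ^ 2) ≤
      (k : ℝ) ^ 2 * (∑ n ∈ G1 W B, SquarefreeSums.wfun W c n / n) ^ k * ((1 + C₀) ^ 2 / (D₀ : ℝ)) := by
    rw [hQ, Finset.sum_product]
    have hPs : ∑ p ∈ (Finset.Ioc D₀ B).filter Nat.Prime, 1 / (p : ℝ) ^ 2 ≤ 1 / (D₀ : ℝ) := by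
      have := SquarefreeSums.sum_primes_inv_sub_sq_le 0 D₀ B (by omega)
      simp only [Nat.cast_zero, sub_zero] at this
      exact this
    have hinner : ∀ ij ∈ (Finset.univ : Finset (Fin k)).offDiag,
        ∑ p ∈ (Finset.Ioc D₀ B).filter Nat.Prime,
          (∑ n ∈ G1 W B, SquarefreeSums.wfun W c n / n) ^ k *
            ((1 + C₀) ^ 2 / ((((ij, p) : (Fin k × Fin k) × ℕ).2 : ℝ)) ^ 2) ≤
        (∑ n ∈ G1 W B, SquarefreeSums.wfun W c n / n) ^ k * ((1 + C₀) ^ 2 * (1 / (D₀ : ℝ))) := by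
      intro ij _
      calc _ = (∑ n ∈ G1 W B, SquarefreeSums.wfun W c n / n) ^ k * ((1 + C₀) ^ 2 *
            ∑ p ∈ (Finset.Ioc D₀ B).filter Nat.Prime, 1 / (p : ℝ) ^ 2) := by
            rw [Finset.mul_sum, Finset.mul_sum]
            refine Finset.sum_congr rfl fun p _ => ?_
            ring
        _ ≤ _ := by gcongr
    calc _ ≤ ∑ ij ∈ (Finset.univ : Finset (Fin k)).offDiag,
          (∑ n ∈ G1 W B, SquarefreeSums.wfun W c n / n) ^ k * ((1 + C₀) ^ 2 * (1 / (D₀ : ℝ))) :=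
          Finset.sum_le_sum hinner
      _ = ((Finset.univ : Finset (Fin k)).offDiag.card : ℝ) *
          ((∑ n ∈ G1 W B, SquarefreeSums.wfun W c n / n) ^ k * ((1 + C₀) ^ 2 * (1 / (D₀ : ℝ)))) := by
          rw [Finset.sum_const, nsmul_eq_mul]
      _ ≤ (k : ℝ) ^ 2 * ((∑ n ∈ G1 W B, SquarefreeSums.wfun W c n / n) ^ k * ((1 + C₀) ^ 2 * (1 / (D₀ : ℝ)))) := by
          have hcard : ((Finset.univ : Finset (Fin k)).offDiag.card : ℝ) ≤ (k : ℝ) ^ 2 := by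
            rw [Finset.offDiag_card, Finset.card_univ, Fintype.card_fin]
            have : k * k - k ≤ k * k := Nat.sub_le _ _
            calc ((k * k - k : ℕ) : ℝ) ≤ ((k * k : ℕ) : ℝ) := by exact_mod_cast this
              _ = (k : ℝ) ^ 2 := by push_cast; ring
          exact mul_le_mul_of_nonneg_right hcard (by positivity)
      _ = _ := by ring
  exact step1.trans (step2.trans ((Finset.sum_le_sum step3).trans step4))

/-! ### The weight `φ(n)²/(g(n) n²)` of Lemma 6.3 as an instance of `w_c/n` -/


/-- `|c_p| ≤ 1/p`. [folklore] -/
theorem abs_cJ_le (p : ℕ) (hp : p.Prime) : |cJ p| ≤ 1 / p := by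
  dsimp only
  by_cases h : p = 2
  · subst h; norm_num
  · have h3 : (3 : ℝ) ≤ p := by
      have := hp.two_le
      have : 3 ≤ p := by omega
      exact_mod_cast this
    have hpos : (0 : ℝ) < ((p : ℝ) - 2) * p := by nlinarith
    rw [abs_of_nonneg (by positivity), div_le_div_iff₀ hpos (by linarith)]
    nlinarith

/-- `1 + c_p ≥ 0`. [folklore] -/
theorem one_add_cJ_nonneg (p : ℕ) (hp : p.Prime) : 0 ≤ 1 + cJ p := by
  have := (abs_le.1 (abs_cJ_le p hp)).1
  have h1 : (1 : ℝ) / p ≤ 1 := by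
    rw [div_le_one (by exact_mod_cast hp.pos)]; exact_mod_cast hp.one_le
  linarith

/-- For squarefree `n` coprime to an even `W`: `w_{cJ}(n)/n = φ(n)²/(g(n) n²)` (`g = maynardG`).
[cite: MaynardAnnals2015, proof of Lemma 6.3, (6.13)] -/
theorem wfun_cJ_div {W n : ℕ} (hW : 2 ∣ W) (hn : n ≠ 0) (hsq : Squarefree n) (hco : n.Coprime W) :
    SquarefreeSums.wfun W cJ n / n = (n.totient : ℝ) ^ 2 / (maynardG n * (n : ℝ) ^ 2) := by
  rw [SquarefreeSums.wfun_apply_of n hn hsq hco, maynardG_of_squarefree hsq]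
  have hφ : (n.totient : ℝ) = ∏ p ∈ n.primeFactors, ((p : ℝ) - 1) := by
    have h := Nat.totient_eq_prod_factorization hn
    rw [h]
    push_cast
    rw [Finsupp.prod, Nat.support_factorization]
    refine Finset.prod_congr rfl fun p hp => ?_
    have hpp := Nat.prime_of_mem_primeFactors hp
    have h1 : n.factorization p = 1 := by
      have := (Nat.squarefree_iff_factorization_le_one hn).1 hsq p
      have hpos : 0 < n.factorization p :=
        Nat.Prime.factorization_pos_of_dvd hpp hn (Nat.dvd_of_mem_primeFactors hp)
      omega
    rw [h1, Nat.cast_sub hpp.one_lt.le]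
    simp
  have hnprod : (n : ℝ) = ∏ p ∈ n.primeFactors, (p : ℝ) := by
    rw [← Nat.cast_prod, Nat.prod_primeFactors_of_squarefree hsq]
  rw [hφ, hnprod, ← Finset.prod_pow, ← Finset.prod_pow, ← Finset.prod_mul_distrib,
    ← Finset.prod_div_distrib, ← Finset.prod_div_distrib]
  refine Finset.prod_congr rfl fun p hp => ?_
  have hpp := Nat.prime_of_mem_primeFactors hp
  have hp2 : p ≠ 2 := by
    rintro rfl
    have : (2 : ℕ) ∣ Nat.gcd n W := Nat.dvd_gcd (Nat.dvd_of_mem_primeFactors hp) hW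
    rw [hco] at this; omega
  have h3 : (3 : ℝ) ≤ p := by
    have := hpp.two_le
    have : 3 ≤ p := by omega
    exact_mod_cast this
  have : (p : ℝ) - 2 ≠ 0 := by linarith
  have : (p : ℝ) ≠ 0 := by linarith
  field_simp
  ring

/-! ### The slot `m`: tuples with `r_m = 1` -/

/-- Reindexing the tuples of `[1, B]^{n+1}` with `r_m = 1` by `(n)`-tuples (`s ↦ insertNth m 1 s`),
preserving goodness (`∏ᵢ rᵢ = ∏ⱼ sⱼ`). [cite: MaynardAnnals2015, proof of Lemma 6.3, (6.12)] -/
theorem sum_filter_slot_eq {n : ℕ} (m : Fin (n + 1)) (W : ℕ) {R : ℝ} (hR : 1 ≤ ⌊R⌋₊)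
    (Φ : (Fin (n + 1) → ℕ) → ℝ) :
    ∑ r ∈ (maynardBox (n + 1) R).filter (fun r => r m = 1 ∧ IsGood W r), Φ r =
      ∑ s ∈ (maynardBox n R).filter (IsGood W), Φ (Fin.insertNth (α := fun _ => ℕ) m 1 s) := by
  classical
  have hprod : ∀ r : Fin (n + 1) → ℕ, r m = 1 → ∏ i, r i = ∏ j, Fin.removeNth m r j := by
    intro r hr
    rw [Fin.prod_univ_succAbove r m, hr, one_mul]
    rfl
  refine Finset.sum_nbij' (fun r => Fin.removeNth m r)
    (fun s => (Fin.insertNth (α := fun _ => ℕ) m 1 s : Fin (n + 1) → ℕ)) ?_ ?_ ?_ ?_ ?_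
  · intro r hr
    rw [Finset.mem_filter, mem_maynardBox_iff] at hr
    obtain ⟨hb, hrm, hg⟩ := hr
    rw [Finset.mem_filter, mem_maynardBox_iff]
    refine ⟨fun j => hb _, ?_⟩
    unfold IsGood at hg ⊢
    rwa [← hprod r hrm]
  · intro s hs
    rw [Finset.mem_filter, mem_maynardBox_iff] at hs
    obtain ⟨hb, hg⟩ := hs
    rw [Finset.mem_filter, mem_maynardBox_iff]
    refine ⟨?_, Fin.insertNth_apply_same (α := fun _ => ℕ) m 1 s, ?_⟩
    · intro i
      refine Fin.succAboveCases m ?_ (fun j => ?_) i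
      · rw [Fin.insertNth_apply_same]; exact ⟨le_rfl, hR⟩
      · rw [Fin.insertNth_apply_succAbove]; exact hb j
    · unfold IsGood at hg ⊢
      rwa [hprod _ (Fin.insertNth_apply_same (α := fun _ => ℕ) m 1 s),
        Fin.removeNth_insertNth (α := fun _ => ℕ)]
  · intro r hr
    rw [Finset.mem_filter] at hr
    have := Fin.insertNth_self_removeNth m r
    rwa [hr.2.1] at this
  · intro s _
    exact Fin.removeNth_insertNth (α := fun _ => ℕ) m 1 s
  · intro r hr
    rw [Finset.mem_filter] at hr
    have := Fin.insertNth_self_removeNth m r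
    rw [hr.2.1] at this
    rw [this]

/-- The weight of Lemma 6.3 at a tuple with `r_m = 1` is the product over the other coordinates
(`φ(1)²/(g(1) · 1) = 1`). [cite: MaynardAnnals2015, proof of Lemma 6.3, (6.12)] -/
theorem prod_weight_insertNth {n : ℕ} (m : Fin (n + 1)) (s : Fin n → ℕ) (w : ℕ → ℝ) (hw : w 1 = 1) :
    ∏ i, w ((Fin.insertNth (α := fun _ => ℕ) m 1 s : Fin (n + 1) → ℕ) i) = ∏ j, w (s j) := by
  rw [Fin.prod_univ_succAbove _ m, Fin.insertNth_apply_same, hw, one_mul]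
  refine Finset.prod_congr rfl fun j _ => ?_
  rw [Fin.insertNth_apply_succAbove]

/-- `F^{(m)}` at a tuple with `r_m = 1` is the fibre integral at the logarithmic position of the other
coordinates: `F^{(m)}_{insertNth m 1 s} = ∫₀¹ F(insertNth m u x_s) du`. [cite: MaynardAnnals2015, proof of Lemma 6.3 (definition of F^(m)_r, p. 14)] -/
theorem maynardFm_insertNth {n : ℕ} (F : (Fin (n + 1) → ℝ) → ℝ) (R : ℝ) (m : Fin (n + 1))
    (s : Fin n → ℕ) :
    maynardFm (n + 1) F R m (Fin.insertNth (α := fun _ => ℕ) m 1 s) =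
      ∫ u in (0 : ℝ)..1, F (Fin.insertNth m u (MaynardTao.logPos R s)) := by
  unfold maynardFm
  have hfun : (fun i => Real.log ((Fin.insertNth (α := fun _ => ℕ) m 1 s : Fin (n + 1) → ℕ) i) / Real.log R) =
      Fin.insertNth m (0 : ℝ) (MaynardTao.logPos R s) := by
    funext i
    refine Fin.succAboveCases m ?_ (fun j => ?_) i
    · rw [Fin.insertNth_apply_same, Fin.insertNth_apply_same]; simp
    · rw [Fin.insertNth_apply_succAbove, Fin.insertNth_apply_succAbove]; rfl
  rw [hfun]
  refine intervalIntegral.integral_congr fun u _ => ?_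
  simp only [Fin.update_insertNth]


/-! ### The fibre integral `g_m(x) = ∫₀¹ F(insertNth m u x) du` on the cube -/

section Fibre

variable {n : ℕ}

/-- Membership in the cube, coordinatewise. [folklore] -/
theorem mem_maynardCube_iff {x : Fin n → ℝ} : x ∈ maynardCube n ↔ ∀ i, x i ∈ Set.Icc (0 : ℝ) 1 :=
  Set.mem_univ_pi

/-- `|1_{R_k} G| ≤ G_max` everywhere if `|G| ≤ G_max` on the cube (`R_k ⊆ [0,1]^k`). [folklore] -/
theorem abs_indicator_simplex_le {G : (Fin (n + 1) → ℝ) → ℝ} {Gmax : ℝ} (hG0 : 0 ≤ Gmax)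
    (hG : ∀ t ∈ maynardCube (n + 1), |G t| ≤ Gmax) (y : Fin (n + 1) → ℝ) :
    |(maynardSimplex (n + 1)).indicator G y| ≤ Gmax := by
  by_cases hy : y ∈ maynardSimplex (n + 1)
  · rw [Set.indicator_of_mem hy]; exact hG y (maynardSimplex_subset_maynardCube _ hy)
  · rw [Set.indicator_of_notMem hy, abs_zero]; exact hG0

/-- `|∫₀¹ F(insertNth m u x) du| ≤ G_max` for `F = 1_{R_k} G`. [folklore] -/
theorem abs_fibreIntegral_le (m : Fin (n + 1)) {G : (Fin (n + 1) → ℝ) → ℝ} {Gmax : ℝ} (hG0 : 0 ≤ Gmax)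
    (hG : ∀ t ∈ maynardCube (n + 1), |G t| ≤ Gmax) (x : Fin n → ℝ) :
    |∫ u in (0 : ℝ)..1, (maynardSimplex (n + 1)).indicator G (Fin.insertNth m u x)| ≤ Gmax := by
  have h := intervalIntegral.norm_integral_le_of_norm_le_const (a := 0) (b := 1) (C := Gmax)
    (f := fun u => (maynardSimplex (n + 1)).indicator G (Fin.insertNth m u x))
    fun u _ => by rw [Real.norm_eq_abs]; exact abs_indicator_simplex_le hG0 hG _
  rw [Real.norm_eq_abs, sub_zero, abs_one, mul_one] at h
  exact h

/-- **Continuity of the fibre integral on the cube**: for continuous `G` and `F = 1_{R_{n+1}} G`,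
`x ↦ ∫₀¹ F(insertNth m u x) du` is continuous on `[0,1]^n` (dominated convergence: for `x` in the cube
and `u ∈ (0,1]`, `insertNth m u x ∈ R_{n+1} ↔ u + ∑ xⱼ ≤ 1`, so `x ↦ F(insertNth m u x)` is continuous
within the cube at `x₀` for every `u ≠ 1 − ∑ x₀ⱼ`). [folklore] -/
theorem continuousOn_fibreIntegral (m : Fin (n + 1)) {G : (Fin (n + 1) → ℝ) → ℝ} (hG : Continuous G) :
    ContinuousOn (fun x : Fin n → ℝ =>
      ∫ u in (0 : ℝ)..1, (maynardSimplex (n + 1)).indicator G (Fin.insertNth m u x)) (maynardCube n) := by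
  intro x₀ hx₀
  obtain ⟨Gmax, hG0, hGmax⟩ : ∃ M : ℝ, 0 ≤ M ∧ ∀ x ∈ maynardCube (n + 1), |G x| ≤ M := by
    obtain ⟨M, hM⟩ := (isCompact_univ_pi fun _ => isCompact_Icc : IsCompact (maynardCube (n + 1))).exists_bound_of_continuousOn hG.continuousOn
    exact ⟨max M 0, le_max_right _ _, fun x hx =>
      (Real.norm_eq_abs (G x) ▸ hM x hx).trans (le_max_left _ _)⟩
  have hFm : Measurable ((maynardSimplex (n + 1)).indicator G) :=
    hG.measurable.indicator (measurableSet_maynardSimplex _)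
  have hx₀' := mem_maynardCube_iff.1 hx₀
  refine intervalIntegral.continuousWithinAt_of_dominated_interval (bound := fun _ => Gmax) ?_ ?_ ?_ ?_
  · exact Filter.Eventually.of_forall fun x =>
      (hFm.comp (continuous_id.finInsertNth m continuous_const).measurable).aestronglyMeasurable
  · exact Filter.Eventually.of_forall fun x => ae_of_all _ fun u _ => by
      rw [Real.norm_eq_abs]; exact abs_indicator_simplex_le hG0 hGmax _
  · exact intervalIntegrable_const
  · have hu : ∀ᵐ u : ℝ ∂volume, u ≠ 1 - ∑ j, x₀ j := by
      rw [ae_iff]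
      have : {u : ℝ | ¬u ≠ 1 - ∑ j, x₀ j} = {1 - ∑ j, x₀ j} := by ext u; simp
      rw [this]; exact measure_singleton _
    refine hu.mono fun u hu hmem => ?_
    rw [Set.uIoc_of_le zero_le_one, Set.mem_Ioc] at hmem
    have hGc : ContinuousWithinAt (fun x : Fin n → ℝ => G (Fin.insertNth m u x)) (maynardCube n) x₀ :=
      (hG.comp (continuous_const.finInsertNth m continuous_id)).continuousWithinAt
    rcases lt_or_gt_of_ne hu with hlt | hgt
    · -- below the face: `F = G` near `x₀` within the cube
      refine hGc.congr_of_eventuallyEq ?_ ?_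
      · have hopen : IsOpen {x : Fin n → ℝ | u + ∑ j, x j < 1} :=
          isOpen_lt (continuous_const.add (continuous_finsetSum _ fun j _ => continuous_apply j))
            continuous_const
        have hx₀mem : x₀ ∈ {x : Fin n → ℝ | u + ∑ j, x j < 1} := by
          simp only [Set.mem_setOf_eq]; linarith
        filter_upwards [inter_mem_nhdsWithin (maynardCube n) (hopen.mem_nhds hx₀mem)] with x hx
        rw [Set.indicator_of_mem]
        rw [MaynardLargeK.insertNth_mem_maynardSimplex_iff]
        exact ⟨⟨hmem.1.le, fun j => (mem_maynardCube_iff.1 hx.1 j).1⟩, le_of_lt hx.2⟩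
      · rw [Set.indicator_of_mem]
        rw [MaynardLargeK.insertNth_mem_maynardSimplex_iff]
        exact ⟨⟨hmem.1.le, fun j => (hx₀' j).1⟩, by linarith⟩
    · -- above the face: `F = 0` near `x₀` within the cube
      refine (continuousWithinAt_const (b := (0 : ℝ))).congr_of_eventuallyEq ?_ ?_
      · have hopen : IsOpen {x : Fin n → ℝ | 1 < u + ∑ j, x j} :=
          isOpen_lt continuous_const
            (continuous_const.add (continuous_finsetSum _ fun j _ => continuous_apply j))
        have hx₀mem : x₀ ∈ {x : Fin n → ℝ | 1 < u + ∑ j, x j} := by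
          simp only [Set.mem_setOf_eq]; linarith
        filter_upwards [inter_mem_nhdsWithin (maynardCube n) (hopen.mem_nhds hx₀mem)] with x hx
        rw [Set.indicator_of_notMem]
        rw [MaynardLargeK.insertNth_mem_maynardSimplex_iff]
        intro h
        have := hx.2
        simp only [Set.mem_setOf_eq] at this
        linarith [h.2]
      · rw [Set.indicator_of_notMem]
        rw [MaynardLargeK.insertNth_mem_maynardSimplex_iff]
        intro h; linarith [h.2]

/-- The logarithmic position of a tuple of the box lies in the cube (`1 ≤ sⱼ ≤ R`). [folklore] -/
theorem logPos_mem_maynardCube {R : ℝ} (hR : 1 < R) {s : Fin n → ℕ} (hs : s ∈ maynardBox n R) :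
    MaynardTao.logPos R s ∈ maynardCube n := by
  rw [mem_maynardCube_iff]
  intro i
  have hs' := mem_maynardBox_iff.1 hs i
  have hlogR : 0 < Real.log R := Real.log_pos hR
  have h1 : (1 : ℝ) ≤ s i := by exact_mod_cast hs'.1
  have h2 : (s i : ℝ) ≤ R := (by exact_mod_cast hs'.2 : (s i : ℝ) ≤ ⌊R⌋₊).trans (Nat.floor_le (by linarith))
  refine ⟨div_nonneg (Real.log_nonneg h1) hlogR.le, ?_⟩
  rw [MaynardTao.logPos, div_le_one hlogR]
  exact Real.log_le_log (by linarith) h2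

/-- With no linear constraint the polytope of the equidistribution lemma is the whole cube. [folklore] -/
theorem polytope_empty_eq (n : ℕ) :
    MaynardTao.polytope (fun e : Empty => (e.elim : Finset (Fin n))) = maynardCube n := by
  ext t
  rw [MaynardTao.mem_polytope]
  simp

/-- `∫_{[0,1]^n} g_m² = J^{(m)}(F)` for the fibre integral `g_m` of `F = 1_{R_{n+1}} G`
(`MaynardLargeK.maynardJ_eq_integral_insertNth`). [cite: MaynardAnnals2015, proof of Lemma 6.3, (6.14)] -/
theorem integral_cube_fibre_sq_eq (m : Fin (n + 1)) (G : (Fin (n + 1) → ℝ) → ℝ) :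
    ∫ x in maynardCube n, (maynardCube n).indicator
        (fun x => (∫ u in (0 : ℝ)..1, (maynardSimplex (n + 1)).indicator G (Fin.insertNth m u x)) ^ 2) x =
      maynardJ (n + 1) m ((maynardSimplex (n + 1)).indicator G) := by
  rw [setIntegral_indicator (MaynardLargeK.measurableSet_maynardCube n), Set.inter_self,
    MaynardLargeK.maynardJ_eq_integral_insertNth m Set.support_indicator_subset]

/-- In dimension `0` the weighted sum is the value at the unique point. [folklore] -/
theorem weightedSum_zero (wt : Fin 0 → ℕ → ℝ) (R : ℝ) (H : (Fin 0 → ℝ) → ℝ) (x : Fin 0 → ℝ) :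
    MaynardTao.weightedSum wt R H = H x := by
  classical
  rw [MaynardTao.weightedSum]
  have hterm : ∀ u ∈ maynardBox 0 R, (∏ i, wt i (u i)) * H (MaynardTao.logPos R u) = H x := by
    intro u _
    rw [Fintype.prod_empty, one_mul, Subsingleton.elim (MaynardTao.logPos R u) x]
  rw [Finset.sum_congr rfl hterm, Finset.sum_const, nsmul_eq_mul]
  have hcard : (maynardBox 0 R).card = 1 := by
    rw [maynardBox, Fintype.card_piFinset, Fintype.prod_empty]
  rw [hcard, Nat.cast_one, one_mul]

/-- In dimension `0` the integral over the cube is the value at the unique point. [folklore] -/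
theorem integral_maynardCube_zero (H : (Fin 0 → ℝ) → ℝ) (x : Fin 0 → ℝ) :
    ∫ t in maynardCube 0, H t = H x := by
  have hH : H = fun _ => H x := funext fun t => by rw [Subsingleton.elim t x]
  have hcube : maynardCube 0 = Set.univ := Set.eq_univ_of_forall fun t => mem_maynardCube_iff.2 fun i => i.elim0
  rw [hH, setIntegral_const, hcube, smul_eq_mul]
  have : (volume : Measure (Fin 0 → ℝ)).real Set.univ = 1 := by
    rw [Measure.real, volume_pi, Measure.pi_univ, Fintype.prod_empty, ENNReal.toReal_one]
  rw [this, one_mul]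

end Fibre


/-! ### The weighted sum for a general weight `w_c/n` and the bad tuples -/

/-- `∑_{n ∈ G1} w(n)/n = ∑_{n ≤ B} w(n)/n` (`w` vanishes off `G1`). [folklore] -/
theorem sum_G1_wfun_div_eq (W B : ℕ) (c : ℕ → ℝ) :
    ∑ n ∈ G1 W B, SquarefreeSums.wfun W c n / n = ∑ n ∈ Finset.Icc 1 B, SquarefreeSums.wfun W c n / n := by
  rw [G1, Finset.sum_filter]
  refine Finset.sum_congr rfl fun n _ => ?_
  split_ifs with h
  · rfl
  · rcases not_and_or.1 h with h | h
    · rw [SquarefreeSums.wfun_eq_zero_of_not_squarefree h, zero_div]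
    · rw [SquarefreeSums.wfun_eq_zero_of_not_coprime h, zero_div]

/-- The weighted sum for the weight `w_c(n)/n` in every coordinate is the sum over the coordinatewise
good tuples. [cite: MaynardAnnals2015, proof of Lemma 6.3, (6.13)] -/
theorem weightedSum_wfun_eq' (W : ℕ) (c : ℕ → ℝ) (R : ℝ) (H : (Fin k → ℝ) → ℝ) :
    MaynardTao.weightedSum (fun (_ : Fin k) (t : ℕ) => SquarefreeSums.wfun W c t / t) R H =
      ∑ r ∈ (maynardBox k R).filter (fun r => ∀ i, Squarefree (r i) ∧ (r i).Coprime W),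
        (∏ i, SquarefreeSums.wfun W c (r i) / (r i)) * H (MaynardTao.logPos R r) := by
  classical
  rw [MaynardTao.weightedSum, Finset.sum_filter]
  refine Finset.sum_congr rfl fun r _ => ?_
  split_ifs with h
  · rfl
  · obtain ⟨i, hi⟩ := not_forall.1 h
    have h0 : SquarefreeSums.wfun W c (r i) / (r i) = 0 := by
      rcases not_and_or.1 hi with h | h
      · rw [SquarefreeSums.wfun_eq_zero_of_not_squarefree h, zero_div]
      · rw [SquarefreeSums.wfun_eq_zero_of_not_coprime h, zero_div]
    rw [Finset.prod_eq_zero (Finset.mem_univ i) h0, zero_mul]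

/-- The weighted sum minus the sum over the good tuples is the sum over the bad tuples.
[cite: MaynardAnnals2015, proof of Lemma 6.3, (6.13)] -/
theorem weightedSum_wfun_sub_eq' (W : ℕ) (c : ℕ → ℝ) (R : ℝ) (H : (Fin k → ℝ) → ℝ) :
    MaynardTao.weightedSum (fun (_ : Fin k) (t : ℕ) => SquarefreeSums.wfun W c t / t) R H -
        ∑ r ∈ (maynardBox k R).filter (IsGood W),
          (∏ i, SquarefreeSums.wfun W c (r i) / (r i)) * H (MaynardTao.logPos R r) =
      ∑ r ∈ (Fintype.piFinset fun _ : Fin k => G1 W ⌊R⌋₊).filter (fun r => ¬IsGood W r),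
        (∏ i, SquarefreeSums.wfun W c (r i) / (r i)) * H (MaynardTao.logPos R r) := by
  classical
  rw [weightedSum_wfun_eq', filter_maynardBox_coord_eq, filter_maynardBox_isGood_eq,
    ← Finset.sum_filter_add_sum_filter_not (Fintype.piFinset fun _ : Fin k => G1 W ⌊R⌋₊) (IsGood W)]
  ring

/-- The sum over the bad tuples is small: `≤ H_max k² L^k (1 + C₀)²/D₀`. [cite: MaynardAnnals2015, proof of Lemma 6.3, (6.13)] -/
theorem abs_sum_bad_wfun_le {W D₀ : ℕ} {R : ℝ} (hD1 : 1 ≤ D₀)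
    (hD : ∀ p, p.Prime → p ≤ D₀ → p ∣ W) {c : ℕ → ℝ} {C₀ : ℝ}
    (hc : ∀ p, p.Prime → |c p| ≤ C₀ / p) (hc1 : ∀ p, p.Prime → 0 ≤ 1 + c p)
    {H : (Fin k → ℝ) → ℝ} {Hmax : ℝ} (hH : ∀ t, |H t| ≤ Hmax) :
    |∑ r ∈ (Fintype.piFinset fun _ : Fin k => G1 W ⌊R⌋₊).filter (fun r => ¬IsGood W r),
        (∏ i, SquarefreeSums.wfun W c (r i) / (r i)) * H (MaynardTao.logPos R r)| ≤
      Hmax * ((k : ℝ) ^ 2 * (∑ n ∈ G1 W ⌊R⌋₊, SquarefreeSums.wfun W c n / n) ^ k * ((1 + C₀) ^ 2 / (D₀ : ℝ))) := by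
  classical
  have hH0 : 0 ≤ Hmax := (abs_nonneg _).trans (hH 0)
  refine (Finset.abs_sum_le_sum_abs _ _).trans ?_
  calc ∑ r ∈ (Fintype.piFinset fun _ : Fin k => G1 W ⌊R⌋₊).filter (fun r => ¬IsGood W r),
        |(∏ i, SquarefreeSums.wfun W c (r i) / (r i)) * H (MaynardTao.logPos R r)|
      ≤ ∑ r ∈ (Fintype.piFinset fun _ : Fin k => G1 W ⌊R⌋₊).filter (fun r => ¬IsGood W r),
        (∏ i, SquarefreeSums.wfun W c (r i) / (r i)) * Hmax := by
        refine Finset.sum_le_sum fun r _ => ?_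
        have hP : 0 ≤ ∏ i, SquarefreeSums.wfun W c (r i) / (r i) :=
          Finset.prod_nonneg fun i _ => wfun_div_nonneg hc1 _
        rw [abs_mul, abs_of_nonneg hP]
        exact mul_le_mul_of_nonneg_left (hH _) hP
    _ = Hmax * ∑ r ∈ (Fintype.piFinset fun _ : Fin k => G1 W ⌊R⌋₊).filter (fun r => ¬IsGood W r),
        ∏ i, SquarefreeSums.wfun W c (r i) / (r i) := by rw [Finset.mul_sum]; exact Finset.sum_congr rfl fun _ _ => mul_comm _ _
    _ ≤ _ := mul_le_mul_of_nonneg_left (sum_prod_wfun_not_isGood_le hD1 hD hc hc1) hH0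

/-! ### The left side of (6.12) as a weighted sum over `(n)`-tuples -/

/-- **(6.12)–(6.13) prepared**: the sum of Lemma 6.3 (tuples `r` of `[1, R]^{n+1}` with `r_m = 1`,
`∏ rᵢ` squarefree and coprime to the even `W`, weight `∏ φ(rᵢ)²/(g(rᵢ)rᵢ²)`, against `(F^{(m)}_r)²`)
equals the sum over the good `n`-tuples `s` of `∏ⱼ w_{cJ}(sⱼ)/sⱼ` against `g_m(x_s)²`, `g_m` the fibre
integral. [cite: MaynardAnnals2015, proof of Lemma 6.3, (6.12)–(6.13)] -/
theorem sum_lemma63_eq_sum_good {n : ℕ} (m : Fin (n + 1)) (G : (Fin (n + 1) → ℝ) → ℝ) {W : ℕ}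
    (hW2 : 2 ∣ W) {R : ℝ} (hR : 1 < R) (hB : 1 ≤ ⌊R⌋₊) :
    ∑ r ∈ (maynardBox (n + 1) R).filter
        (fun r => r m = 1 ∧ Squarefree (∏ i, r i) ∧ Nat.Coprime (∏ i, r i) W),
        (∏ i, (Nat.totient (r i) : ℝ) ^ 2 / (maynardG (r i) * (r i : ℝ) ^ 2)) *
          maynardFm (n + 1) ((maynardSimplex (n + 1)).indicator G) R m r ^ 2 =
      ∑ s ∈ (maynardBox n R).filter (IsGood W),
        (∏ j, SquarefreeSums.wfun W cJ (s j) / (s j)) *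
          (maynardCube n).indicator (fun x => (∫ u in (0 : ℝ)..1,
            (maynardSimplex (n + 1)).indicator G (Fin.insertNth m u x)) ^ 2) (MaynardTao.logPos R s) := by
  classical
  have hfilt : (maynardBox (n + 1) R).filter
      (fun r => r m = 1 ∧ Squarefree (∏ i, r i) ∧ Nat.Coprime (∏ i, r i) W) =
      (maynardBox (n + 1) R).filter (fun r => r m = 1 ∧ IsGood W r) :=
    Finset.filter_congr fun r _ => Iff.rfl
  rw [hfilt, sum_filter_slot_eq m W hB]
  refine Finset.sum_congr rfl fun s hs => ?_
  rw [Finset.mem_filter] at hs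
  obtain ⟨hsb, hsg⟩ := hs
  have hw := prod_weight_insertNth m s (fun t => (Nat.totient t : ℝ) ^ 2 / (maynardG t * (t : ℝ) ^ 2))
    (by simp [maynardG_one])
  rw [hw, maynardFm_insertNth, Set.indicator_of_mem (logPos_mem_maynardCube hR hsb)]
  congr 1
  refine Finset.prod_congr rfl fun j _ => ?_
  have hs0 : s j ≠ 0 := by have := (mem_maynardBox_iff.1 hsb j).1; omega
  rw [wfun_cJ_div hW2 hs0 (hsg.squarefree_apply j) (hsg.coprime_apply j)]

end MaynardSieve

open MaynardSieve MaynardTao in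
/-- **Maynard 2015, proof of Lemma 6.3, (6.12)–(6.14)** — the named fact `Literature.NumberTheory.Sieve.maynard_lemma63_sum` of
`MaynardSieveS2.lean`, PROVED: for `F = 1_{R_k} G` (`G ∈ C¹`; only continuity is used), `k = n + 1`,
`∑_{r : r_m = 1, ∏ rᵢ sq.free, (∏ rᵢ, W) = 1} ∏ φ(rᵢ)²/(g(rᵢ)rᵢ²) (F^{(m)}_r)² = (φ(W)/W)^n (log R)^n (J_k^{(m)}(F) + o(1))`.
Proof: the slot `m` is removed (`sum_lemma63_eq_sum_good`: the `n` remaining coordinates carry the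
weight `w_{cJ}(s)/s = μ² 1_W φ²/(g · id²)(s)`, `c_p = 1/((p−2)p)`, and the function `g_m(x_s)²` with
`g_m(x) = ∫₀¹ F(insertNth m u x) du`); the condition "`∏ sⱼ` squarefree" is relaxed to coordinatewise at
the cost `≪ n² L^n/D₀` ((6.13), `abs_sum_bad_wfun_le`); the `n` applications of Lemma 6.1 are replaced
by the tree's Riemann-sum estimate `MaynardTao.abs_weightedSum_sub_integral_le` (no constraint polytope:
`g_m` is continuous on the whole cube, `continuousOn_fibreIntegral`, and vanishes past the face
`∑ xⱼ = 1`), fed with the counting function of `w_{cJ}/id` (`SquarefreeSums.abs_sum_wfun_div_sub_log_le`);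
finally `∫_{[0,1]^n} g_m² = J^{(m)}(F)` (`MaynardLargeK.maynardJ_eq_integral_insertNth`). The case
`n = 0` (`k = 1`) is degenerate (one tuple, one point). [cite: MaynardAnnals2015, proof of Lemma 6.3, (6.12)–(6.14)] -/
theorem maynard_lemma63_sum_holds : maynard_lemma63_sum := by
  intro k θ δ hδ hη G hG m
  obtain ⟨n, rfl⟩ : ∃ n, k = n + 1 := ⟨k - 1, by have := m.pos; omega⟩
  classical
  simp only [Nat.add_sub_cancel]
  have hGc : Continuous G := hG.continuous
  have hcubeK1 : IsCompact (maynardCube (n + 1)) := isCompact_univ_pi fun _ => isCompact_Icc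
  have hcubeK : IsCompact (maynardCube n) := isCompact_univ_pi fun _ => isCompact_Icc
  obtain ⟨Gmax, hG0, hGmax⟩ : ∃ M : ℝ, 0 ≤ M ∧ ∀ x ∈ maynardCube (n + 1), |G x| ≤ M := by
    obtain ⟨M, hM⟩ := hcubeK1.exists_bound_of_continuousOn hGc.continuousOn
    exact ⟨max M 0, le_max_right _ _, fun x hx =>
      (Real.norm_eq_abs (G x) ▸ hM x hx).trans (le_max_left _ _)⟩
  -- the fibre integral and its square
  obtain ⟨gm, hgm⟩ : ∃ g : (Fin n → ℝ) → ℝ, g = fun x =>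
      ∫ u in (0 : ℝ)..1, (maynardSimplex (n + 1)).indicator G (Fin.insertNth m u x) := ⟨_, rfl⟩
  have hgm_c : ContinuousOn gm (maynardCube n) := by rw [hgm]; exact continuousOn_fibreIntegral m hGc
  have hgm_b : ∀ x, |gm x| ≤ Gmax := fun x => by rw [hgm]; exact abs_fibreIntegral_le m hG0 hGmax x
  obtain ⟨g₂, hg₂⟩ : ∃ g : (Fin n → ℝ) → ℝ, g = fun x => gm x ^ 2 := ⟨_, rfl⟩
  have hg2c : ContinuousOn g₂ (maynardCube n) := by rw [hg₂]; exact hgm_c.pow 2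
  have hg2b : ∀ x, |g₂ x| ≤ Gmax ^ 2 := fun x => by
    rw [hg₂]; dsimp only; rw [abs_pow]; exact pow_le_pow_left₀ (abs_nonneg _) (hgm_b x) 2
  have hH2 : 0 ≤ Gmax ^ 2 := by positivity
  -- the polytope data (no constraint)
  obtain ⟨S, hS⟩ : ∃ S : Empty → Finset (Fin n), S = fun e => e.elim := ⟨_, rfl⟩
  have hPoly : polytope S = maynardCube n := by rw [hS]; exact polytope_empty_eq n
  obtain ⟨H, hHdef⟩ : ∃ H : (Fin n → ℝ) → ℝ, H = (polytope S).indicator g₂ := ⟨_, rfl⟩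
  have hHb : ∀ t, |H t| ≤ Gmax ^ 2 := fun t => by
    rw [hHdef]
    by_cases ht : t ∈ polytope S
    · rw [Set.indicator_of_mem ht]; exact hg2b t
    · rw [Set.indicator_of_notMem ht, abs_zero]; positivity
  have hint : IntegrableOn ((polytope S).indicator g₂) (maynardCube n) volume := by
    refine (hg2c.integrableOn_compact hcubeK).indicator ?_
    rw [hPoly]; exact MaynardLargeK.measurableSet_maynardCube n
  have hIint : ∫ t in maynardCube n, (polytope S).indicator g₂ t =
      maynardJ (n + 1) m ((maynardSimplex (n + 1)).indicator G) := by
    rw [hPoly, hg₂, hgm]; exact integral_cube_fibre_sq_eq m G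
  have hL' : ∑ l, ((S l).card + 1 : ℝ) = 0 := by simp
  have huc : UniformContinuousOn g₂ (maynardCube n) := hcubeK.uniformContinuousOn_of_continuous hg2c
  -- the target
  rw [Asymptotics.isLittleO_iff]
  intro ε₀ hε₀
  obtain ⟨ε₁, hε₁⟩ : ∃ e : ℝ, e = min ε₀ 1 := ⟨_, rfl⟩
  have hε₁0 : 0 < ε₁ := by rw [hε₁]; exact lt_min hε₀ one_pos
  have hε₁1 : ε₁ ≤ 1 := by rw [hε₁]; exact min_le_right _ _
  have hε₁ε : ε₁ ≤ ε₀ := by rw [hε₁]; exact min_le_left _ _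
  obtain ⟨δ₁, hδ₁, hδ⟩ := Metric.uniformContinuousOn_iff.1 huc (ε₁ / 16) (by positivity)
  obtain ⟨M, hM1⟩ : ∃ M : ℕ, 1 / δ₁ < M := ⟨⌈1 / δ₁⌉₊ + 1, by
    calc 1 / δ₁ ≤ ⌈1 / δ₁⌉₊ := Nat.le_ceil _
      _ < _ := by push_cast; linarith⟩
  have hM0 : (0 : ℝ) < M := lt_of_le_of_lt (by positivity) hM1
  have hMpos : 0 < M := by exact_mod_cast hM0
  have hcont : ∀ t ∈ maynardCube n, ∀ t' ∈ maynardCube n,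
      (∀ i, |t i - t' i| ≤ 1 / (M : ℝ)) → |g₂ t - g₂ t'| ≤ ε₁ / 16 := by
    intro t ht t' ht' hd
    have h1 : dist t t' ≤ 1 / (M : ℝ) :=
      (dist_pi_le_iff (by positivity)).2 fun i => by rw [Real.dist_eq]; exact hd i
    have h2 : 1 / (M : ℝ) < δ₁ := by
      rw [div_lt_iff₀ hM0]
      calc (1 : ℝ) = δ₁ * (1 / δ₁) := by field_simp
        _ < δ₁ * M := by gcongr
    have := hδ t ht t' ht' (by linarith)
    rw [Real.dist_eq] at this
    exact this.le
  -- `η₀`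
  obtain ⟨A, hA⟩ : ∃ A : ℝ, A = Gmax ^ 2 * n * 2 ^ (n - 1) + n * 2 ^ (n - 1) + 1 := ⟨_, rfl⟩
  have hA0 : 0 < A := by rw [hA]; positivity
  obtain ⟨η₀, hη₀⟩ : ∃ e : ℝ, e = min 1 (ε₁ / (8 * A)) := ⟨_, rfl⟩
  have hη₀0 : 0 < η₀ := by rw [hη₀]; exact lt_min one_pos (by positivity)
  have hη₀1 : η₀ ≤ 1 := by rw [hη₀]; exact min_le_left _ _
  have hη₀A : A * η₀ ≤ ε₁ / 8 := by
    have : η₀ ≤ ε₁ / (8 * A) := by rw [hη₀]; exact min_le_right _ _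
    rw [le_div_iff₀ (by positivity)] at this
    linarith
  -- constants for `L` and the bad tuples
  obtain ⟨b, hb⟩ : ∃ b : ℝ, b = SquarefreeSums.bConst 1 := ⟨_, rfl⟩
  have hb0 : 0 < b := by rw [hb]; unfold SquarefreeSums.bConst; positivity
  obtain ⟨CL, hCL⟩ : ∃ C : ℝ, C = 2 + b := ⟨_, rfl⟩
  have hCL0 : 0 ≤ CL := by rw [hCL]; positivity
  obtain ⟨Dbad, hDbad⟩ : ∃ D : ℕ, D = ⌈16 * Gmax ^ 2 * (n : ℝ) ^ 2 * CL ^ n / ε₁⌉₊ + 1 := ⟨_, rfl⟩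
  have hεD : ∀ᶠ N : ℕ in atTop, b * (maynardD0 N : ℝ) ^ (-(1 : ℝ) / 4) ≤ η₀ / (4 * M) := by
    have h1 : Tendsto (fun N : ℕ => b * (maynardD0 N : ℝ) ^ (-(1 / 4 : ℝ))) atTop (nhds (b * 0)) :=
      ((tendsto_rpow_neg_atTop (by norm_num : (0 : ℝ) < 1 / 4)).comp tendsto_maynardD0_atTop).const_mul b
    rw [mul_zero] at h1
    have h2 := h1.eventually (eventually_le_nhds (show (0 : ℝ) < η₀ / (4 * M) by positivity))
    filter_upwards [h2] with N hN
    have : (-(1 : ℝ) / 4) = -(1 / 4 : ℝ) := by norm_num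
    rw [this]; exact hN
  filter_upwards [eventually_one_le_loglog, tendsto_maynardD0_atTop'.eventually_ge_atTop (max 3 Dbad),
    eventually_two_le_maynardR hη,
    eventually_mul_loglog_pow_le_log (13 * b) 3
      (show (0 : ℝ) < (θ / 2 - δ) * (η₀ / (4 * M)) by positivity),
    hεD, eventually_ge_atTop 1] with N hll hD0 hR2 hE3 hεN hN1
  -- basic facts on `D₀, W, R, B = ⌊R⌋`
  have hD3 : 3 ≤ maynardD0 N := le_of_max_le_left hD0
  have hDbadle : Dbad ≤ maynardD0 N := le_of_max_le_right hD0
  have hD1 : 1 ≤ maynardD0 N := by omega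
  have hDr : (3 : ℝ) ≤ maynardD0 N := by exact_mod_cast hD3
  have hDpos : (0 : ℝ) < maynardD0 N := by linarith
  have hW0 : maynardW N ≠ 0 := primorial_ne_zero _
  have hWpos : (0 : ℝ) < maynardW N := by exact_mod_cast primorial_pos _
  have hDW : ∀ p, p.Prime → p ≤ maynardD0 N → p ∣ maynardW N := fun p hp hpD =>
    (Nat.Prime.dvd_primorial_iff hp).2 hpD
  have hW2 : 2 ∣ maynardW N := hDW 2 Nat.prime_two (by omega)
  have hR1 : 1 < maynardR θ δ N := by linarith
  have hRpos : 0 < maynardR θ δ N := by linarith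
  have hB1 : 1 ≤ ⌊maynardR θ δ N⌋₊ := Nat.le_floor (by simp only [Nat.cast_one]; linarith)
  have hNpos : (0 : ℝ) < N := by exact_mod_cast hN1
  have hlogR : Real.log (maynardR θ δ N) = (θ / 2 - δ) * Real.log N := by
    rw [maynardR, Real.log_rpow hNpos]
  have hlogR0 : 0 < Real.log (maynardR θ δ N) := Real.log_pos hR1
  -- `φ_W = φ(W)/W`
  obtain ⟨φW, hφW⟩ : ∃ x : ℝ, x = (Nat.totient (maynardW N) : ℝ) / maynardW N := ⟨_, rfl⟩
  have hφWpos : 0 < φW := by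
    rw [hφW]; exact div_pos (by exact_mod_cast Nat.totient_pos.2 (primorial_pos _)) hWpos
  have hφWD : 1 / (maynardD0 N : ℝ) ≤ φW := hφW ▸ one_div_le_totient_primorial_div hD1
  obtain ⟨P, hP⟩ : ∃ P : ℝ, P = φW * Real.log (maynardR θ δ N) := ⟨_, rfl⟩
  have hP0 : 0 < P := by rw [hP]; positivity
  have hScale : ((Nat.totient (maynardW N) : ℝ) / (maynardW N)) ^ n * Real.log (maynardR θ δ N) ^ n = P ^ n := by
    rw [hP, hφW, mul_pow]
  -- `E3`: `(harmErr W + 4) b ≤ (η₀/(4M)) P`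
  obtain ⟨E, hE⟩ : ∃ E : ℝ, E = (SquarefreeSums.harmErr (maynardW N) + 4) * b := ⟨_, rfl⟩
  have hE0 : 0 ≤ E := by
    rw [hE]
    have : 0 ≤ SquarefreeSums.harmErr (maynardW N) := SquarefreeSums.harmErr_nonneg _
    positivity
  have hE3' : E ≤ η₀ / (4 * M) * P := by
    have h16 : (16 : ℝ) ^ maynardD0 N ≤ Real.log (Real.log N) ^ 3 :=
      (pow_maynardD0_le (c := 16) (by norm_num) hll).trans
        (pow_le_pow_right₀ hll natCeil_log_sixteen_le)
    have hharm := harmErr_primorial_add_four_le hD1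
    have hD2D : (maynardD0 N : ℝ) ≤ 2 ^ maynardD0 N := by exact_mod_cast (Nat.lt_two_pow_self).le
    have key : E * maynardD0 N ≤ η₀ / (4 * M) * Real.log (maynardR θ δ N) := by
      calc E * maynardD0 N ≤ ((13 * 8 ^ maynardD0 N) * b) * 2 ^ maynardD0 N := by
            rw [hE]; gcongr
            unfold maynardW; linarith
        _ = (13 * b) * 16 ^ maynardD0 N := by
            rw [show (16 : ℝ) = 8 * 2 by norm_num, mul_pow]; ring
        _ ≤ (13 * b) * Real.log (Real.log N) ^ 3 := by gcongr
        _ ≤ (θ / 2 - δ) * (η₀ / (4 * M)) * Real.log N := hE3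
        _ = η₀ / (4 * M) * Real.log (maynardR θ δ N) := by rw [hlogR]; ring
    calc E = E * maynardD0 N * (1 / maynardD0 N) := by field_simp
      _ ≤ (η₀ / (4 * M) * Real.log (maynardR θ δ N)) * φW :=
          mul_le_mul key hφWD (by positivity) (by positivity)
      _ = η₀ / (4 * M) * P := by rw [hP]; ring
  have hEP : E ≤ P := by
    refine hE3'.trans ?_
    have : η₀ / (4 * M) ≤ 1 := by
      rw [div_le_one (by positivity)]
      have : (1 : ℝ) ≤ M := by exact_mod_cast hMpos
      linarith
    exact mul_le_of_le_one_left hP0.le this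
  -- `L ≤ CL · P`
  obtain ⟨L, hLdef⟩ : ∃ L : ℝ, L = ∑ t ∈ G1 (maynardW N) ⌊maynardR θ δ N⌋₊,
      SquarefreeSums.wfun (maynardW N) cJ t / t := ⟨_, rfl⟩
  have hL0 : 0 ≤ L := by
    rw [hLdef]; exact Finset.sum_nonneg fun _ _ => wfun_div_nonneg one_add_cJ_nonneg _
  have hcount : ∀ y : ℝ, 1 ≤ y →
      |∑ t ∈ Finset.Icc 1 ⌊y⌋₊, SquarefreeSums.wfun (maynardW N) cJ t / t - φW * Real.log y| ≤
        E + φW * (b * (maynardD0 N : ℝ) ^ (-(1 : ℝ) / 4)) * Real.log y := by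
    intro y hy
    rw [hφW, hE, hb]
    exact SquarefreeSums.abs_sum_wfun_div_sub_log_le hW0 abs_cJ_le hD1 hDW hy
  have hL : L ≤ CL * P := by
    have h := hcount (maynardR θ δ N) hR1.le
    rw [← sum_G1_wfun_div_eq, ← hLdef] at h
    have h' := (abs_sub_le_iff.1 h).1
    have hD14 : (maynardD0 N : ℝ) ^ (-(1 : ℝ) / 4) ≤ 1 :=
      Real.rpow_le_one_of_one_le_of_nonpos (by linarith) (by norm_num)
    calc L ≤ φW * Real.log (maynardR θ δ N) +
          (E + φW * (b * (maynardD0 N : ℝ) ^ (-(1 : ℝ) / 4)) * Real.log (maynardR θ δ N)) := by linarith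
      _ ≤ φW * Real.log (maynardR θ δ N) + (P + φW * (b * 1) * Real.log (maynardR θ δ N)) := by
          gcongr
      _ = CL * P := by rw [hCL, hP]; ring
  -- (6.13): the bad tuples
  have hbad := abs_sum_bad_wfun_le (k := n) (H := H) (R := maynardR θ δ N) hD1 hDW abs_cJ_le
    one_add_cJ_nonneg hHb
  rw [← hLdef] at hbad
  have hbad' : Gmax ^ 2 * ((n : ℝ) ^ 2 * L ^ n * ((1 + 1) ^ 2 / (maynardD0 N : ℝ))) ≤ ε₁ / 4 * P ^ n := by
    have hDb : 16 * Gmax ^ 2 * (n : ℝ) ^ 2 * CL ^ n / ε₁ ≤ (maynardD0 N : ℝ) := by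
      have h1 : (Dbad : ℝ) ≤ maynardD0 N := by exact_mod_cast hDbadle
      rw [hDbad] at h1
      push_cast at h1
      linarith [Nat.le_ceil (16 * Gmax ^ 2 * (n : ℝ) ^ 2 * CL ^ n / ε₁)]
    have h16 : 16 * Gmax ^ 2 * (n : ℝ) ^ 2 * CL ^ n ≤ (maynardD0 N : ℝ) * ε₁ := by
      rwa [div_le_iff₀ hε₁0] at hDb
    rw [show Gmax ^ 2 * ((n : ℝ) ^ 2 * L ^ n * ((1 + 1) ^ 2 / (maynardD0 N : ℝ))) =
      4 * Gmax ^ 2 * (n : ℝ) ^ 2 * L ^ n / maynardD0 N by ring, div_le_iff₀ hDpos]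
    calc 4 * Gmax ^ 2 * (n : ℝ) ^ 2 * L ^ n ≤ 4 * Gmax ^ 2 * (n : ℝ) ^ 2 * (CL * P) ^ n := by gcongr
      _ = (16 * Gmax ^ 2 * (n : ℝ) ^ 2 * CL ^ n) * (P ^ n / 4) := by rw [mul_pow]; ring
      _ ≤ ((maynardD0 N : ℝ) * ε₁) * (P ^ n / 4) := by gcongr
      _ = ε₁ / 4 * P ^ n * (maynardD0 N : ℝ) := by ring
  -- the weighted sum vs the integral
  have hT : |weightedSum (fun (_ : Fin n) (t : ℕ) =>
      SquarefreeSums.wfun (maynardW N) cJ t / t) (maynardR θ δ N) H -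
      P ^ n * maynardJ (n + 1) m ((maynardSimplex (n + 1)).indicator G)| ≤ P ^ n * (ε₁ / 2) := by
    rcases Nat.eq_zero_or_pos n with hn | hn
    · subst hn
      rw [← hIint, weightedSum_zero _ _ H (fun i => i.elim0), integral_maynardCube_zero _ (fun i => i.elim0),
        ← hHdef, pow_zero, one_mul, sub_self, abs_zero, one_mul]
      positivity
    · have hH : ∀ i : Fin n, ∀ y : ℝ, 1 ≤ y →
          |massUpTo ((fun (_ : Fin n) (t : ℕ) =>
              SquarefreeSums.wfun (maynardW N) cJ t / t) i) ⌊y⌋₊ - φW * Real.log y| ≤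
            b * (maynardD0 N : ℝ) ^ (-(1 : ℝ) / 4) * φW * Real.log y + E := by
        intro i y hy
        have h := hcount y hy
        rw [MaynardTao.massUpTo]
        exact h.trans (le_of_eq (by ring))
      have hmain := abs_weightedSum_sub_integral_le hn S
        (fun _ u => wfun_div_nonneg one_add_cJ_nonneg u)
        hφWpos (by positivity : 0 ≤ b * (maynardD0 N : ℝ) ^ (-(1 : ℝ) / 4)) hE0 hH hR1 hMpos
        (by positivity : (0 : ℝ) ≤ ε₁ / 16) hH2 hcont (fun t _ => hg2b t) hint
      rw [hIint, hL', ← hP, ← hHdef] at hmain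
      obtain ⟨η, hηdef⟩ : ∃ e : ℝ, e = 2 * M * (b * (maynardD0 N : ℝ) ^ (-(1 : ℝ) / 4) + E / P) := ⟨_, rfl⟩
      rw [← hηdef] at hmain
      have hη0 : 0 ≤ η := by rw [hηdef]; positivity
      have hηle : η ≤ η₀ := by
        have h2 : E / P ≤ η₀ / (4 * M) := by rw [div_le_iff₀ hP0]; exact hE3'
        calc η ≤ 2 * M * (η₀ / (4 * M) + η₀ / (4 * M)) := by rw [hηdef]; gcongr
          _ = η₀ := by field_simp; ring
      have hη1 : η ≤ 1 := hηle.trans hη₀1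
      have hηk' : (n : ℝ) * η * 2 ^ (n - 1) ≤ 1 / 8 := by
        have : (n : ℝ) * 2 ^ (n - 1) * η₀ ≤ A * η₀ := by
          refine mul_le_mul_of_nonneg_right ?_ hη₀0.le
          have hu : (0 : ℝ) ≤ Gmax ^ 2 * n * 2 ^ (n - 1) := by positivity
          rw [hA]; linarith
        calc (n : ℝ) * η * 2 ^ (n - 1) = (n : ℝ) * 2 ^ (n - 1) * η := by ring
          _ ≤ (n : ℝ) * 2 ^ (n - 1) * η₀ := by gcongr
          _ ≤ A * η₀ := this
          _ ≤ ε₁ / 8 := hη₀A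
          _ ≤ 1 / 8 := by linarith
      have hηk : Gmax ^ 2 * ((n : ℝ) * η * 2 ^ (n - 1)) ≤ ε₁ / 8 := by
        have : Gmax ^ 2 * (n : ℝ) * 2 ^ (n - 1) * η₀ ≤ A * η₀ := by
          refine mul_le_mul_of_nonneg_right ?_ hη₀0.le
          have hv : (0 : ℝ) ≤ n * 2 ^ (n - 1) := by positivity
          rw [hA]; linarith
        calc Gmax ^ 2 * ((n : ℝ) * η * 2 ^ (n - 1)) = Gmax ^ 2 * (n : ℝ) * 2 ^ (n - 1) * η := by ring
          _ ≤ Gmax ^ 2 * (n : ℝ) * 2 ^ (n - 1) * η₀ := by gcongr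
          _ ≤ A * η₀ := this
          _ ≤ ε₁ / 8 := hη₀A
      have hbr := bracket_le (k := n) (H := Gmax ^ 2) (q := 0) hH2 hη0 rfl le_rfl (by positivity)
        hηk hηk' hη1
      refine hmain.trans (mul_le_mul_of_nonneg_left ?_ (by positivity))
      have hz : 2 * Gmax ^ 2 * (0 : ℝ) / M = 0 := by simp
      rw [hz] at *
      simpa using hbr
  -- assemble
  have hLHS := sum_lemma63_eq_sum_good m G hW2 hR1 hB1
  have hHcube : (maynardCube n).indicator g₂ = H := by rw [hHdef, hPoly]
  rw [hg₂, hgm] at hHcube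
  rw [hHcube] at hLHS
  have hdiff := weightedSum_wfun_sub_eq' (maynardW N) cJ (maynardR θ δ N) H
  rw [Real.norm_eq_abs, Real.norm_eq_abs, hScale, abs_of_pos (pow_pos hP0 n), hLHS]
  have hsplit : ∀ (x T s : ℝ), |x - s| ≤ |T - x| + |T - s| := fun x T s => by
    calc |x - s| = |(T - s) - (T - x)| := by ring_nf
      _ ≤ |T - s| + |T - x| := abs_sub _ _
      _ = _ := add_comm _ _
  refine (hsplit _ (weightedSum (fun (_ : Fin n) (t : ℕ) =>
    SquarefreeSums.wfun (maynardW N) cJ t / t) (maynardR θ δ N) H) _).trans ?_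
  rw [hdiff]
  have hfin : ε₁ / 4 * P ^ n + P ^ n * (ε₁ / 2) ≤ ε₀ * P ^ n := by
    have e : ε₁ / 4 * P ^ n + P ^ n * (ε₁ / 2) = (3 / 4 * ε₁) * P ^ n := by ring
    rw [e]
    exact mul_le_mul_of_nonneg_right (by linarith) (pow_pos hP0 n).le
  exact (add_le_add hbad hT).trans ((add_le_add hbad' le_rfl).trans hfin)

end Literature.NumberTheory.Sieve
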